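import Literature.NumberTheory.Automorphic.UnitaryGroupCohomologicalForms
import Literature.NumberTheory.Automorphic.UnitaryGroupAdelicProduct
import Literature.NumberTheory.Automorphic.UnitaryGroupArchSection
import Literature.NumberTheory.Automorphic.UnitaryGroupArchProjectionEmb
import Literature.AlgebraicGeometry.ShimuraVarieties.UnitaryBallHolomorphyCriterion
import Literature.Geometry.ComplexHyperbolic.UnitBallJacobian
import Summits.HodgeConjecture.HodgeConjecture.Theorems.F0P2aStubDensity
import HarnessLib

/-!
# FLOOR-0 P2a · B4-ARCHIMEDEAN DESK, line 2 `F0_P2aCohIsotypicLine` — the CM FRAME `(L, ι, H, T, hT)`: `U(2,1)`-slices of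
# holomorphic cotangent forms and the factorisation `U(H)(𝔸_{L⁺}) = ι_∞(U(2,1)) · K_c · U(H)(𝔸_{L⁺,f})` for `(cmArchSection, cmCompactFactor)`

Cell hodgecm-mathlib (D-0151), FLOOR 0; crux item H413 = stmt-HodgeConjecture-24833 (route `HCCMUnconditional`); line
`Cruxes/H413/Lines/F0_P2aCohIsotypicLine.lean` (F0P2a-plan (g2), sha16 fe64be0a9875628f), seat F0P2a-p03 (g0), desk supports **B5 / L2b**
(and the factorisation step (1) of S2β `stub_density`).  THEOREMS ONLY (no `def`, no instance, no notation, no named fact, no `sorry`);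
`--supports stmt-HodgeConjecture-24833`.  HC_CM is proved only modulo the 7 printed citations until rung 0 closes; this file discharges none.

## What is proved
* §1 (ANY group `G`, any `ιinf : U(2,1) →* G`): a weight form `f : G → ℂ²` of cotangent `K_∞`-type along `ιinf` with holomorphic germs along
  `ιinf` (`CotangentForms.IsHolGerm`) has every `U(2,1)`-slice `u ↦ f (x · ιinf u)` equal to the group function `toGroupFun cotangentCocycle x₀ Fb`
  of a HOLOMORPHIC `Fb : 𝔹² → ℂ²` (first-order Cauchy–Riemann criterion ★ `BallForms.mem_holWeightForms_of_differentiableAt`), hence continuous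
  (★ `BallForms.continuous_of_mem_holomorphic`, ★ `continuous_toGroupFun_matrixCocycle`) — `exists_mem_holomorphic_slice_eq`, `continuous_slice`
  (generic form of ★ `P2StubU2lL2Realisation.continuous_slice`; [Borel1997, §5.14]).
* §2 (generic unitary datum `(F, E, c, N, J)`): a `K_f`-smooth `ℂ²`-valued function (`CotangentForms.smoothFun`) is fixed by ONE open subgroup of
  `U(J)(𝔸_{F,f})` — `exists_isOpen_forall_rightRep_eq` (generic form of ★ `CuspCot.exists_isOpen_forall_rightRep_eq`; [BorelJacquet1979, §4.2]).
* §3 (the CM frame; NO definiteness hypothesis; the unfoldings `cmArchSection_apply`, `finPart_cmArchSection`,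
  `archToAdelic_archPart_cmArchSection` and the `K_c`-part lemma `exists_mem_cmCompactFactor_archToAdelic_eq` are F0P2a-p05's ★
  `Theorems/F0P2aStubDensity` §CMFrame, imported): the three factors `ι_∞(U(2,1))`, `K_c = cmCompactFactor`, `U(H)(𝔸_{L⁺,f})` pairwise commute
  (`cmArchSection_mul_finAdelicToAdelic`, `cmArchSection_mul_of_mem_cmCompactFactor`, `mul_finAdelicToAdelic_of_mem_cmCompactFactor`); every
  adelic `x` is
  `cmArchSection (pr_ι x_∞) · k · (1, x_f)` (`exists_eq_cmArchSection_mul_cmCompactFactor_mul_finAdelicToAdelic`), and a right-`K_c`-invariant `f`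
  satisfies `f x = f ((1, x_f) · cmArchSection (pr_ι x_∞))` (`apply_eq_apply_cmSlice`) — the frame form of ★ `P4StubT1ArchFactor.archFactorOf_isHonest`
  clauses (3)–(6) and of ★ `P2StubU2lL2Realisation.apply_eq_apply_slice` ([BorelJacquet1979, §4.1]; [PlatonovRapinchuk1994, §5.1]).

## References
* [BorelJacquet1979] A. Borel, H. Jacquet, Corvallis PSPM 33.1, §4.1–4.2.  [Borel1997] A. Borel, *Automorphic forms on SL₂(ℝ)*, §5.14.
* [PlatonovRapinchuk1994] V. Platonov, A. Rapinchuk, §3.2 Thm. 3.1, §5.1.  [Bump1997] D. Bump, §3.2.  [BorelWallach2000] VII 2.10.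
* Tree: ★ `Theorems/F0P2aStubDensity` §CMFrame (F0P2a-p05), ★ `Theorems/P2StubU2lL2Realisation`, `Theorems/P4StubT1ArchFactor` (the pin versions), ★ `Automorphic/UnitaryGroupCohomologicalForms` §5,
  `UnitaryGroupArchSection` §3, `UnitaryGroupArchProjectionEmb`, `UnitaryGroupAdelicProduct`, ★ `ShimuraVarieties/UnitaryBallHolomorphyCriterion`,
  `UnitaryBallAutomorphicForms`, ★ `ComplexHyperbolic/UnitBallJacobian`.
-/

set_option autoImplicit false

-- the mandated namespace has the single-problem summit's repeated segment (`HodgeConjecture.HodgeConjecture`)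
set_option linter.dupNamespace false

noncomputable section

namespace Summit.HodgeConjecture.HodgeConjecture.Cruxes.H413.F0P2aCmFrameFactorisation

open NumberField NumberField.InfinitePlace MulAction Topology Filter
open scoped Matrix
open Literature.NumberTheory.Automorphic Literature.NumberTheory.Automorphic.UnitaryGroup
open Literature.NumberTheory.Automorphic.AutomorphyFactor
open Literature.AlgebraicGeometry.ShimuraVarieties
open Literature.Geometry.ComplexHyperbolic.BallModel (U21 x₀ Ball continuous_Jac_transpose)
open Literature.NumberTheory.Automorphic.UnitaryGroup.CotangentForms (cmArchSection cmCompactFactor)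
open Summit.HodgeConjecture.HodgeConjecture.Cruxes.H413.F0P2aStubDensity (finPart_cmArchSection archToAdelic_archPart_cmArchSection)

/-! ## §1 `U(2,1)`-slices of a cotangent weight form with holomorphic germs (any group, any section) -/

section Slice

variable {G : Type*} [Group G] (ιinf : ↥U21 →* G) {Γ : Subgroup G}

/-- **A `U(2,1)`-slice of a cotangent weight form with holomorphic germs is the group function of a holomorphic ball function.**
For any group `G`, any `ιinf : U(2,1) →* G`, any `f : G → ℂ²` of right `K_∞`-type the cotangent isotropy representation along `ιinf`
with holomorphic germs along `ιinf`, and any base point `x`, there is a HOLOMORPHIC `Fb : 𝔹² → ℂ²` with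
`f (x · ιinf u) = ᵗJac(u, x₀) · Fb (u · x₀)` for all `u ∈ U(2,1)`. [cite: Borel1997, §5.14] [cite: BorelWallach2000, VII 2.10] -/
theorem exists_mem_holomorphic_slice_eq {f : G → (Fin 2 → ℂ)}
    (hW : f ∈ weightForms Γ (ιinf.comp (stabilizer (↥U21) x₀).subtype) (BallForms.isPullbackCocycle_cotangentCocycle.weightOf x₀))
    (hH : CotangentForms.IsHolGerm ιinf f) (x : G) :
    ∃ Fb : Ball → (Fin 2 → ℂ), Fb ∈ BallForms.holomorphic (Fin 2 → ℂ) ∧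
      (fun u : ↥U21 => f (x * ιinf u)) = toGroupFun BallForms.cotangentCocycle x₀ Fb := by
  -- the slice is a weight form on `U(2,1)` for the trivial arithmetic group
  set fx : ↥U21 → (Fin 2 → ℂ) := fun u => f (x * ιinf u) with hfx_def
  have hfx : fx ∈ weightForms (⊥ : Subgroup ↥U21) (stabilizer (↥U21) x₀).subtype
      (BallForms.isPullbackCocycle_cotangentCocycle.weightOf x₀) := by
    refine ⟨fun γ hγ u => ?_, fun k u => ?_⟩
    · rw [Subgroup.mem_bot] at hγ
      rw [hγ, one_mul]
    · show f (x * ιinf (u * (k : ↥U21))) = _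
      rw [map_mul, ← mul_assoc]
      exact hW.2 k (x * ιinf u)
  -- holomorphic germs along `ιinf` = the Cauchy–Riemann hypotheses of the criterion
  have hgerm : ∀ g : ↥U21, (fun b : Fin 2 → ℂ => fx (g * BallForms.expP b)) = CotangentForms.germAt ιinf f (x * ιinf g) := by
    intro g
    funext b
    simp only [hfx_def, CotangentForms.germAt, map_mul, mul_assoc]
  have hmem := BallForms.mem_holWeightForms_of_differentiableAt (Δ := (⊥ : Subgroup ↥U21)) ⟨fx, hfx⟩
    (fun g => by
      show DifferentiableAt ℝ (fun b : Fin 2 → ℂ => fx (g * BallForms.expP b)) 0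
      rw [hgerm g]; exact hH.1 _)
    (fun g v => by
      show fderiv ℝ (fun b : Fin 2 → ℂ => fx (g * BallForms.expP b)) 0 (Complex.I • v) =
        Complex.I • fderiv ℝ (fun b : Fin 2 → ℂ => fx (g * BallForms.expP b)) 0 v
      rw [hgerm g]; exact hH.2 _ v)
  -- unpack: the slice is the group function of a holomorphic function on the ball
  obtain ⟨Fb, hFb, hFbeq⟩ := Submodule.mem_map.1 hmem
  refine ⟨(Fb : factorForms (⊥ : Subgroup ↥U21) BallForms.cotangentCocycle), ?_, ?_⟩
  · exact (BallForms.mem_holFactorForms_iff.1 (Submodule.mem_comap.1 hFb)).2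
  · exact (congrArg Subtype.val hFbeq).symm

/-- **A `U(2,1)`-slice of a cotangent weight form with holomorphic germs is continuous** (any group, any section, any base point).
[cite: Borel1997, §5.14] [cite: Bump1997, §3.2] -/
theorem continuous_slice {f : G → (Fin 2 → ℂ)}
    (hW : f ∈ weightForms Γ (ιinf.comp (stabilizer (↥U21) x₀).subtype) (BallForms.isPullbackCocycle_cotangentCocycle.weightOf x₀))
    (hH : CotangentForms.IsHolGerm ιinf f) (x : G) :
    Continuous fun u : ↥U21 => f (x * ιinf u) := by
  obtain ⟨Fb, hFb, heq⟩ := exists_mem_holomorphic_slice_eq ιinf hW hH x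
  rw [heq]
  exact continuous_toGroupFun_matrixCocycle (continuous_Jac_transpose x₀) (BallForms.continuous_of_mem_holomorphic hFb)

end Slice

/-! ## §2 Smooth vectors of the finite-adelic right translation are fixed by ONE open subgroup (generic unitary datum) -/

section Smooth

variable {F E : Type} [Field F] [NumberField F] [Field E] [NumberField E] [Algebra F E]
  {c : E ≃ₐ[F] E} {N : ℕ} {J : Matrix (Fin N) (Fin N) E}

/-- A `K_f`-smooth function (an element of the span of the `K`-invariants over open `K ≤ U(J)(𝔸_{F,f})`) is fixed by ONE open subgroup
(finite intersections of open subgroups are open). Generic form of ★ `CuspCot.exists_isOpen_forall_rightRep_eq`. [cite: BorelJacquet1979, §4.2] -/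
theorem exists_isOpen_forall_rightRep_eq {f : (adelicGroupData F E c N J).Adelic → (Fin 2 → ℂ)}
    (hf : f ∈ CotangentForms.smoothFun F E c N J) :
    ∃ K : Subgroup (finAdelic F E c N J), IsOpen (K : Set (finAdelic F E c N J)) ∧
      ∀ k ∈ K, CotangentForms.rightRep F E c N J k f = f := by
  refine Submodule.iSup_induction _
    (motive := fun f => ∃ K : Subgroup (finAdelic F E c N J), IsOpen (K : Set (finAdelic F E c N J)) ∧
      ∀ k ∈ K, CotangentForms.rightRep F E c N J k f = f) hf ?_ ?_ ?_
  · intro K f' hf'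
    refine Submodule.iSup_induction _
      (motive := fun f => ∃ K : Subgroup (finAdelic F E c N J), IsOpen (K : Set (finAdelic F E c N J)) ∧
        ∀ k ∈ K, CotangentForms.rightRep F E c N J k f = f) hf' ?_ ?_ ?_
    · intro hK f'' hf''
      exact ⟨K, hK, fun k hk => (Representation.mem_invariants _ _).1 hf'' ⟨k, hk⟩⟩
    · exact ⟨⊤, isOpen_univ, fun k _ => by simp⟩
    · rintro a b ⟨Ka, hKa, ha⟩ ⟨Kb, hKb, hb⟩
      refine ⟨Ka ⊓ Kb, ?_, fun k hk => by rw [map_add, ha k hk.1, hb k hk.2]⟩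
      rw [Subgroup.coe_inf]; exact hKa.inter hKb
  · exact ⟨⊤, isOpen_univ, fun k _ => by simp⟩
  · rintro a b ⟨Ka, hKa, ha⟩ ⟨Kb, hKb, hb⟩
    refine ⟨Ka ⊓ Kb, ?_, fun k hk => by rw [map_add, ha k hk.1, hb k hk.2]⟩
    rw [Subgroup.coe_inf]; exact hKa.inter hKb

end Smooth

/-! ## §3 The frame factorisation `U(H)(𝔸_{L⁺}) = ι_∞(U(2,1)) · K_c · U(H)(𝔸_{L⁺,f})` for `(cmArchSection, cmCompactFactor)` -/

section Frame

variable (L : Type) [Field L] [NumberField L] [IsCMField L] (ι : L →+* ℂ) (H : Matrix (Fin 3) (Fin 3) L) (T : GL (Fin 3) ℂ)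
  (hT : (T : Matrix (Fin 3) (Fin 3) ℂ)ᴴ * H.map ι * (T : Matrix (Fin 3) (Fin 3) ℂ) = Literature.Geometry.ComplexHyperbolic.BallModel.J)

/-- **`ι_∞(U(2,1))` commutes with `U(H)(𝔸_{L⁺,f})`** inside `U(H)(𝔸_{L⁺})`. [cite: BorelJacquet1979, §4.1] -/
theorem cmArchSection_mul_finAdelicToAdelic (u : ↥U21)
    (g : finAdelic (↥(maximalRealSubfield L)) L (IsCMField.complexConj L) 3 H) :
    cmArchSection L ι H T hT u * finAdelicToAdelic (↥(maximalRealSubfield L)) L (IsCMField.complexConj L) 3 H g =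
      finAdelicToAdelic (↥(maximalRealSubfield L)) L (IsCMField.complexConj L) 3 H g * cmArchSection L ι H T hT u :=
  (commute_archSectionU21CM_of_mem_awayFromCM L ι H T hT u
    (finAdelicToAdelic_mem_awayFrom (↥(maximalRealSubfield L)) L (IsCMField.complexConj L) 3 H
      (IsCMField.complexConj_ne_one L) (complexConj_smul_infinitePlace L) _ g)).eq.symm

/-- Membership in `cmCompactFactor`: `k = (a, 1)` with `a` archimedean of trivial `ι`-component `pr_ι a = 1`. [cite: BorelJacquet1979, §4.1] -/
theorem mem_cmCompactFactor_iff (k : (adelicGroupData (↥(maximalRealSubfield L)) L (IsCMField.complexConj L) 3 H).Adelic) :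
    k ∈ cmCompactFactor L ι H T hT ↔
      ∃ a : arch (↥(maximalRealSubfield L)) L (IsCMField.complexConj L) 3 H,
        archProjU21EmbCM L H ι T (formCongr_eq_of_conjTranspose L ι H T hT) a = 1 ∧
          archToAdelic (↥(maximalRealSubfield L)) L (IsCMField.complexConj L) 3 H a = k := by
  rw [CotangentForms.cmCompactFactor_eq, Subgroup.mem_map]
  simp only [MonoidHom.mem_ker]

/-- Elements of `cmCompactFactor` lie in the subgroup `awayFromCM` of elements with trivial `w(ι)`-component. [cite: BorelJacquet1979, §4.1] -/
theorem mem_awayFromCM_of_mem_cmCompactFactor {k : (adelicGroupData (↥(maximalRealSubfield L)) L (IsCMField.complexConj L) 3 H).Adelic}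
    (hk : k ∈ cmCompactFactor L ι H T hT) : k ∈ awayFromCM 3 L ι H := by
  obtain ⟨a, ha, rfl⟩ := (mem_cmCompactFactor_iff L ι H T hT k).1 hk
  have ha' : a ∈ (archAt (↥(maximalRealSubfield L)) L (IsCMField.complexConj L) 3 H (placeOf L ι (isComplex_mk_of_isCMField L ι))
      (complexConj_smul_infinitePlace L _) (IsCMField.complexConj_ne_one L)).ker := by
    rw [← ker_archProjU21Emb (↥(maximalRealSubfield L)) L (IsCMField.complexConj L) H ι (isComplex_mk_of_isCMField L ι) T
      (formCongr_eq_of_conjTranspose L ι H T hT) (complexConj_smul_infinitePlace L _) (IsCMField.complexConj_ne_one L)]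
    exact MonoidHom.mem_ker.2 ha
  exact (archToAdelic_mem_awayFrom_iff (↥(maximalRealSubfield L)) L (IsCMField.complexConj L) 3 H (IsCMField.complexConj_ne_one L)
    (complexConj_smul_infinitePlace L) _ a).2 (MonoidHom.mem_ker.1 ha')

/-- **`ι_∞(U(2,1))` commutes with `K_c`** inside `U(H)(𝔸_{L⁺})`. [cite: BorelJacquet1979, §4.1] -/
theorem cmArchSection_mul_of_mem_cmCompactFactor (u : ↥U21)
    {k : (adelicGroupData (↥(maximalRealSubfield L)) L (IsCMField.complexConj L) 3 H).Adelic} (hk : k ∈ cmCompactFactor L ι H T hT) :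
    cmArchSection L ι H T hT u * k = k * cmArchSection L ι H T hT u :=
  (commute_archSectionU21CM_of_mem_awayFromCM L ι H T hT u (mem_awayFromCM_of_mem_cmCompactFactor L ι H T hT hk)).eq.symm

/-- **`K_c` commutes with `U(H)(𝔸_{L⁺,f})`** inside `U(H)(𝔸_{L⁺})`. [cite: BorelJacquet1979, §4.1] -/
theorem mul_finAdelicToAdelic_of_mem_cmCompactFactor
    {k : (adelicGroupData (↥(maximalRealSubfield L)) L (IsCMField.complexConj L) 3 H).Adelic} (hk : k ∈ cmCompactFactor L ι H T hT)
    (g : finAdelic (↥(maximalRealSubfield L)) L (IsCMField.complexConj L) 3 H) :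
    k * finAdelicToAdelic (↥(maximalRealSubfield L)) L (IsCMField.complexConj L) 3 H g =
      finAdelicToAdelic (↥(maximalRealSubfield L)) L (IsCMField.complexConj L) 3 H g * k := by
  obtain ⟨a, -, rfl⟩ := (mem_cmCompactFactor_iff L ι H T hT k).1 hk
  exact (commute_archToAdelic_finAdelicToAdelic (↥(maximalRealSubfield L)) L (IsCMField.complexConj L) 3 H a g).eq

/-- **Product decomposition in the frame**: every `x ∈ U(H)(𝔸_{L⁺})` is `cmArchSection u · k · (1, g)` with `k ∈ cmCompactFactor`
(`u = pr_ι x_∞`, `g = x_f`). [cite: BorelJacquet1979, §4.1] [cite: PlatonovRapinchuk1994, §5.1] -/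
theorem exists_eq_cmArchSection_mul_cmCompactFactor_mul_finAdelicToAdelic
    (x : (adelicGroupData (↥(maximalRealSubfield L)) L (IsCMField.complexConj L) 3 H).Adelic) :
    ∃ k ∈ cmCompactFactor L ι H T hT,
      x = cmArchSection L ι H T hT (archProjU21EmbCM L H ι T (formCongr_eq_of_conjTranspose L ι H T hT)
            (archPart (↥(maximalRealSubfield L)) L (IsCMField.complexConj L) 3 H x)) * k *
          finAdelicToAdelic (↥(maximalRealSubfield L)) L (IsCMField.complexConj L) 3 H
            (finPart (↥(maximalRealSubfield L)) L (IsCMField.complexConj L) 3 H x) := by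
  obtain ⟨k, hk, hdec⟩ := F0P2aStubDensity.exists_mem_cmCompactFactor_archToAdelic_eq L ι H T hT
    (archPart (↥(maximalRealSubfield L)) L (IsCMField.complexConj L) 3 H x)
  refine ⟨k, hk, ?_⟩
  rw [← hdec]
  exact (archToAdelic_mul_finAdelicToAdelic (↥(maximalRealSubfield L)) L (IsCMField.complexConj L) 3 H x).symm

/-- **Slice decomposition in the frame.**  For a right `K_c`-invariant `f` and every `x ∈ U(H)(𝔸_{L⁺})`:
`f x = f ((1, x_f) · cmArchSection (pr_ι x_∞))` — the archimedean component factors as `cmArchSection (pr_ι x_∞)` times an element of the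
compact factor, which commutes past `(1, x_f)` and is absorbed by `f`. [cite: BorelJacquet1979, §4.1] [cite: PlatonovRapinchuk1994, §5.1] -/
theorem apply_eq_apply_cmSlice {X : Type*} {f : (adelicGroupData (↥(maximalRealSubfield L)) L (IsCMField.complexConj L) 3 H).Adelic → X}
    (hK : ∀ k ∈ cmCompactFactor L ι H T hT, ∀ x, f (x * k) = f x)
    (x : (adelicGroupData (↥(maximalRealSubfield L)) L (IsCMField.complexConj L) 3 H).Adelic) :
    f x = f (finAdelicToAdelic (↥(maximalRealSubfield L)) L (IsCMField.complexConj L) 3 H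
        (finPart (↥(maximalRealSubfield L)) L (IsCMField.complexConj L) 3 H x) *
      cmArchSection L ι H T hT (archProjU21EmbCM L H ι T (formCongr_eq_of_conjTranspose L ι H T hT)
        (archPart (↥(maximalRealSubfield L)) L (IsCMField.complexConj L) 3 H x))) := by
  obtain ⟨k, hk, hx⟩ := exists_eq_cmArchSection_mul_cmCompactFactor_mul_finAdelicToAdelic L ι H T hT x
  rw [mul_assoc, mul_finAdelicToAdelic_of_mem_cmCompactFactor L ι H T hT hk, ← mul_assoc,
    cmArchSection_mul_finAdelicToAdelic] at hx
  rw [congrArg f hx]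
  exact hK k hk _

end Frame

end Summit.HodgeConjecture.HodgeConjecture.Cruxes.H413.F0P2aCmFrameFactorisation

end
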